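/-
Copyright (c) 2026 the pub-hodgecm-mathlib formalisation cell (harness21).  Prover seat hodgecm-mathlib-K2Liu-p10 (g4), Track B «K2-LIT»,
#184♮ = hLiu418 = `stmt-HodgeConjecture-24832`; organ S2 «ARCH SPAN BY K-TYPE PATHS», file S2-K K-3 (LEAD F0P6-plan (g14) BATCH #10 (3) «K-3 chain rule IS YOURS —
you own `ev` and `∂`; p16's PART B differentiates the FUNCTION `v ↦ A(k_v)` with an abstract derivative binder and S2-asm plugs it from K-3»).  KERNEL: theorems only.
-/
import Summits.HodgeConjecture.HodgeConjecture.Theorems.K2LiuU22CompactPictureDefs   -- ★ p860097 DEFS leaf (`Carrier`, `uMat`, `dInv`, `pd`, `evalAt`)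
import Mathlib.Analysis.Calculus.Deriv.Add
import Mathlib.Analysis.Calculus.Deriv.Mul
import Mathlib.Analysis.Calculus.Deriv.Inv
import Mathlib.Analysis.Calculus.Deriv.Comp
import Mathlib.Analysis.Complex.Basic
import HarnessLib

/-!
# Crux `HLiu418`, organ S2, file S2-K K-3: THE CHAIN RULE THROUGH THE EVALUATION MAP — formal `∂_{ij}` = honest `∂_{ij}`
# `d/dt ev_{γ(t)}(a) = Σ_{ij} ev_{γ(t₀)}(∂_{ij} a) · γ′_{ij}(t₀)` for every `a ∈ 𝒜 = ℂ[u, D⁻¹]` and every entrywise-differentiable matrix curve `γ` in `GL₂(ℂ)`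

Cell `hodgecm-mathlib`, crux item hLiu418 = `stmt-HodgeConjecture-24832`, route of record `HCCMUnconditional`; squad K2 ∕ K2Liu, prover K2Liu-p10 (g4).
THEOREMS ONLY (no `def`, no `instance`, no notation, no named-fact hypothesis, no `sorry`); lane `--supports stmt-HodgeConjecture-24832 --as helper`.

This is the ONLY place analysis touches the S2-K carrier (census 8412f86940febae5 §2): for a curve `γ : ℝ → M₂(ℂ)` with `HasDerivAt (t ↦ γ t i j) (γ′ i j) t₀` for all
`i, j` and `det γ(t) ≠ 0` for all `t` (the compact-picture curves `k_u · exp(tX)` of ★ S2-P are unitary), and for EVERY element `a` of the abstract ring `𝒜`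
(★ `Carrier = Localization.Away detPoly`), the function `t ↦ ev_{γ(t)}(a)` (★ `evalAt`) is differentiable at `t₀` with derivative `Σ_{ij} ev_{γ(t₀)}(∂_{ij}a)·γ′_{ij}`
(★ `pd`).  PROOF: the set of `a` for which this holds contains the scalars, the coordinates `u_{ij}` (`pd_uMat`) and `D⁻¹` (quotient rule + `pd_dInv`), and is closed
under `+` and `·` (Leibniz on both sides); every `a` is `P(u)·(D⁻¹)^n` (★ `IsLocalization.surj`).  [KashiwaraVergne1978, §II.5; LeeZhu1998, p. 5032.]
* §1 `hasDerivAt_det_fin_two` (Jacobi for `2×2`), the closure lemmas; §2 **`hasDerivAt_evalAt`** (the chain rule), `hasDerivAt_evalAt_of_forall` (curried form for S2-asm).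

HONEST LABEL: HC_CM is proved only modulo the 7 printed citations (2 remaining named inputs: hLiu418 = stmt-HodgeConjecture-24832, h413 = stmt-HodgeConjecture-24833)
until rung 0 closes; helper, closes no item.
References: [KashiwaraVergne1978] Invent. Math. 44 (1978) §II.5; [LeeZhu1998] Trans. AMS 350 (1998) p. 5032.
-/

set_option autoImplicit false
set_option linter.dupNamespace false -- the mandated namespace repeats `HodgeConjecture.HodgeConjecture`

noncomputable section

open Matrix MvPolynomial
open Summit.HodgeConjecture.HodgeConjecture.Cruxes.HLiu418.K2LiuU22CompactPictureDefs

namespace Summit.HodgeConjecture.HodgeConjecture.Cruxes.HLiu418.K2LiuU22CompactPictureChainRule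

variable (γ : ℝ → Matrix (Fin 2) (Fin 2) ℂ) (γ' : Matrix (Fin 2) (Fin 2) ℂ) (t₀ : ℝ)
  (hγ : ∀ i j : Fin 2, HasDerivAt (fun t => γ t i j) (γ' i j) t₀) (hdet : ∀ t, (γ t).det ≠ 0)

/-! ## §1 The determinant of a curve and the closure lemmas -/

/-- **Jacobi's formula for `2×2` curves**: `d/dt det γ = γ′₀₀γ₁₁ + γ₀₀γ′₁₁ − (γ′₀₁γ₁₀ + γ₀₁γ′₁₀)`. [folklore] -/
theorem hasDerivAt_det_fin_two (hγ : ∀ i j : Fin 2, HasDerivAt (fun t => γ t i j) (γ' i j) t₀) :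
    HasDerivAt (fun t => (γ t).det) (γ' 0 0 * γ t₀ 1 1 + γ t₀ 0 0 * γ' 1 1 - (γ' 0 1 * γ t₀ 1 0 + γ t₀ 0 1 * γ' 1 0)) t₀ := by
  have h : (fun t => (γ t).det) = fun t => γ t 0 0 * γ t 1 1 - γ t 0 1 * γ t 1 0 := by
    funext t; rw [Matrix.det_fin_two]
  rw [h]
  exact HasDerivAt.sub (HasDerivAt.mul (hγ 0 0) (hγ 1 1)) (HasDerivAt.mul (hγ 0 1) (hγ 1 0))

/-- the formal derivative of `det u` evaluated along the curve IS the derivative of `det γ`: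
`Σ_{ij} ev(∂_{ij} det u)·γ′_{ij} = d/dt det γ`. [folklore] -/
theorem sum_evalAt_pd_det (h0 : (γ t₀).det ≠ 0) :
    ∑ i : Fin 2, ∑ j : Fin 2, evalAt (γ t₀) h0 (pd i j uMat.det) * γ' i j =
      γ' 0 0 * γ t₀ 1 1 + γ t₀ 0 0 * γ' 1 1 - (γ' 0 1 * γ t₀ 1 0 + γ t₀ 0 1 * γ' 1 0) := by
  simp only [Matrix.det_fin_two, map_sub, Derivation.leibniz, pd_uMat, smul_eq_mul, Fin.sum_univ_two, map_add, map_mul, evalAt_uMat, and_true,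
    and_false, if_true, if_false, zero_ne_one, one_ne_zero, mul_one, mul_zero, add_zero, zero_add, map_zero, map_one]
  ring

include hdet in
/-- closure under products: if the chain rule holds for `a` and `b` it holds for `a·b` (Leibniz on both sides). [folklore] -/
theorem hasDerivAt_evalAt_mul {a b : Carrier}
    (ha : HasDerivAt (fun t => evalAt (γ t) (hdet t) a) (∑ i : Fin 2, ∑ j : Fin 2, evalAt (γ t₀) (hdet t₀) (pd i j a) * γ' i j) t₀)
    (hb : HasDerivAt (fun t => evalAt (γ t) (hdet t) b) (∑ i : Fin 2, ∑ j : Fin 2, evalAt (γ t₀) (hdet t₀) (pd i j b) * γ' i j) t₀) :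
    HasDerivAt (fun t => evalAt (γ t) (hdet t) (a * b)) (∑ i : Fin 2, ∑ j : Fin 2, evalAt (γ t₀) (hdet t₀) (pd i j (a * b)) * γ' i j) t₀ := by
  have e1 : (fun t => evalAt (γ t) (hdet t) (a * b)) = fun t => evalAt (γ t) (hdet t) a * evalAt (γ t) (hdet t) b :=
    funext fun t => map_mul _ a b
  have e2 : ∑ i : Fin 2, ∑ j : Fin 2, evalAt (γ t₀) (hdet t₀) (pd i j (a * b)) * γ' i j =
      (∑ i : Fin 2, ∑ j : Fin 2, evalAt (γ t₀) (hdet t₀) (pd i j a) * γ' i j) * evalAt (γ t₀) (hdet t₀) b +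
        evalAt (γ t₀) (hdet t₀) a * ∑ i : Fin 2, ∑ j : Fin 2, evalAt (γ t₀) (hdet t₀) (pd i j b) * γ' i j := by
    simp only [Derivation.leibniz, smul_eq_mul, map_add, map_mul]
    rw [Finset.sum_mul, Finset.mul_sum, ← Finset.sum_add_distrib]
    refine Finset.sum_congr rfl fun i _ => ?_
    rw [Finset.sum_mul, Finset.mul_sum, ← Finset.sum_add_distrib]
    refine Finset.sum_congr rfl fun j _ => ?_
    ring
  rw [e1, e2]
  exact HasDerivAt.mul ha hb

include hdet in
/-- closure under sums. [folklore] -/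
theorem hasDerivAt_evalAt_add {a b : Carrier}
    (ha : HasDerivAt (fun t => evalAt (γ t) (hdet t) a) (∑ i : Fin 2, ∑ j : Fin 2, evalAt (γ t₀) (hdet t₀) (pd i j a) * γ' i j) t₀)
    (hb : HasDerivAt (fun t => evalAt (γ t) (hdet t) b) (∑ i : Fin 2, ∑ j : Fin 2, evalAt (γ t₀) (hdet t₀) (pd i j b) * γ' i j) t₀) :
    HasDerivAt (fun t => evalAt (γ t) (hdet t) (a + b)) (∑ i : Fin 2, ∑ j : Fin 2, evalAt (γ t₀) (hdet t₀) (pd i j (a + b)) * γ' i j) t₀ := by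
  have e1 : (fun t => evalAt (γ t) (hdet t) (a + b)) = fun t => evalAt (γ t) (hdet t) a + evalAt (γ t) (hdet t) b :=
    funext fun t => map_add _ a b
  have e2 : ∑ i : Fin 2, ∑ j : Fin 2, evalAt (γ t₀) (hdet t₀) (pd i j (a + b)) * γ' i j =
      (∑ i : Fin 2, ∑ j : Fin 2, evalAt (γ t₀) (hdet t₀) (pd i j a) * γ' i j) + ∑ i : Fin 2, ∑ j : Fin 2, evalAt (γ t₀) (hdet t₀) (pd i j b) * γ' i j := by
    simp only [map_add, add_mul, Finset.sum_add_distrib]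
  rw [e1, e2]
  exact HasDerivAt.add ha hb

include hdet in
/-- the scalars: `ev(c) = c` is constant and `∂_{ij} c = 0`. [folklore] -/
theorem hasDerivAt_evalAt_algebraMap (c : ℂ) :
    HasDerivAt (fun t => evalAt (γ t) (hdet t) (algebraMap ℂ Carrier c)) (∑ i : Fin 2, ∑ j : Fin 2, evalAt (γ t₀) (hdet t₀) (pd i j (algebraMap ℂ Carrier c)) * γ' i j) t₀ := by
  simp only [Algebra.algebraMap_eq_smul_one, map_smul, map_one, smul_eq_mul, mul_one, Derivation.map_smul, Derivation.map_one_eq_zero, smul_zero, map_zero,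
    zero_mul, Finset.sum_const_zero]
  exact hasDerivAt_const t₀ c

include hγ hdet in
/-- the coordinates: `ev_{γ(t)}(u_{ij}) = γ(t)_{ij}` and `∂_{i′j′} u_{ij} = δ`. [folklore] -/
theorem hasDerivAt_evalAt_uMat (i j : Fin 2) :
    HasDerivAt (fun t => evalAt (γ t) (hdet t) (uMat i j)) (∑ i' : Fin 2, ∑ j' : Fin 2, evalAt (γ t₀) (hdet t₀) (pd i' j' (uMat i j)) * γ' i' j') t₀ := by
  have h : ∑ i' : Fin 2, ∑ j' : Fin 2, evalAt (γ t₀) (hdet t₀) (pd i' j' (uMat i j)) * γ' i' j' = γ' i j := by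
    simp only [pd_uMat]
    rw [Finset.sum_eq_single i (fun i' _ hi' => Finset.sum_eq_zero fun j' _ => by rw [if_neg (fun h => hi' h.1), map_zero, zero_mul])
      (fun h => absurd (Finset.mem_univ i) h),
      Finset.sum_eq_single j (fun j' _ hj' => by rw [if_neg (fun h => hj' h.2), map_zero, zero_mul]) (fun h => absurd (Finset.mem_univ j) h),
      if_pos ⟨rfl, rfl⟩, map_one, one_mul]
  have e1 : (fun t => evalAt (γ t) (hdet t) (uMat i j)) = fun t => γ t i j := funext fun t => evalAt_uMat _ _ i j
  rw [h, e1]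
  exact hγ i j

include hγ hdet in
/-- `D⁻¹`: `ev_{γ(t)}(D⁻¹) = det(γ(t))⁻¹` (inverse rule) and `∂_{ij} D⁻¹ = −D⁻²∂_{ij}D` evaluated (`sum_evalAt_pd_det`). [folklore] -/
theorem hasDerivAt_evalAt_dInv :
    HasDerivAt (fun t => evalAt (γ t) (hdet t) dInv) (∑ i : Fin 2, ∑ j : Fin 2, evalAt (γ t₀) (hdet t₀) (pd i j dInv) * γ' i j) t₀ := by
  have hD := hasDerivAt_det_fin_two γ γ' t₀ hγ
  have hinv := HasDerivAt.comp t₀ (hasDerivAt_inv (hdet t₀)) hD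
  have e1 : (fun t => evalAt (γ t) (hdet t) dInv) = (fun y : ℂ => y⁻¹) ∘ fun t => (γ t).det :=
    funext fun t => evalAt_dInv _ _
  have e2 : ∑ i : Fin 2, ∑ j : Fin 2, evalAt (γ t₀) (hdet t₀) (pd i j dInv) * γ' i j =
      -((γ t₀).det ^ 2)⁻¹ * (γ' 0 0 * γ t₀ 1 1 + γ t₀ 0 0 * γ' 1 1 - (γ' 0 1 * γ t₀ 1 0 + γ t₀ 0 1 * γ' 1 0)) := by
    rw [← sum_evalAt_pd_det γ γ' t₀ (hdet t₀), Finset.mul_sum]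
    refine Finset.sum_congr rfl fun i _ => ?_
    rw [Finset.mul_sum]
    refine Finset.sum_congr rfl fun j _ => ?_
    rw [pd_dInv, map_mul, map_neg, map_mul, evalAt_dInv]
    ring
  rw [e1, e2]
  exact hinv

include hγ hdet in
/-- powers of `D⁻¹` satisfy the chain rule. [folklore] -/
theorem hasDerivAt_evalAt_dInv_pow (n : ℕ) :
    HasDerivAt (fun t => evalAt (γ t) (hdet t) (dInv ^ n)) (∑ i : Fin 2, ∑ j : Fin 2, evalAt (γ t₀) (hdet t₀) (pd i j (dInv ^ n)) * γ' i j) t₀ := by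
  induction n with
  | zero =>
    rw [pow_zero, ← map_one (algebraMap ℂ Carrier)]
    exact hasDerivAt_evalAt_algebraMap γ γ' t₀ hdet 1
  | succ n ih =>
    rw [pow_succ]
    exact hasDerivAt_evalAt_mul γ γ' t₀ hdet ih (hasDerivAt_evalAt_dInv γ γ' t₀ hγ hdet)

/-! ## §2 The chain rule -/

include hγ hdet in
/-- polynomials in the coordinates satisfy the chain rule. [folklore] -/
theorem hasDerivAt_evalAt_algebraMap_mvPolynomial (P : MvPolynomial (Fin 2 × Fin 2) ℂ) :
    HasDerivAt (fun t => evalAt (γ t) (hdet t) (algebraMap (MvPolynomial (Fin 2 × Fin 2) ℂ) Carrier P))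
      (∑ i : Fin 2, ∑ j : Fin 2, evalAt (γ t₀) (hdet t₀) (pd i j (algebraMap (MvPolynomial (Fin 2 × Fin 2) ℂ) Carrier P)) * γ' i j) t₀ := by
  induction P using MvPolynomial.induction_on with
  | C c =>
    have hc : algebraMap (MvPolynomial (Fin 2 × Fin 2) ℂ) Carrier (C c) = algebraMap ℂ Carrier c :=
      (IsScalarTower.algebraMap_apply ℂ (MvPolynomial (Fin 2 × Fin 2) ℂ) Carrier c).symm
    rw [hc]
    exact hasDerivAt_evalAt_algebraMap γ γ' t₀ hdet c
  | add p q hp hq => rw [map_add]; exact hasDerivAt_evalAt_add γ γ' t₀ hdet hp hq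
  | mul_X p ij hp =>
    rw [map_mul]
    have hX : algebraMap (MvPolynomial (Fin 2 × Fin 2) ℂ) Carrier (X ij) = uMat ij.1 ij.2 := rfl
    rw [hX]
    exact hasDerivAt_evalAt_mul γ γ' t₀ hdet hp (hasDerivAt_evalAt_uMat γ γ' t₀ hγ hdet ij.1 ij.2)

include hγ hdet in
/-- **THE CHAIN RULE THROUGH THE EVALUATION MAP** (formal `∂` = honest `∂`): for every `a ∈ 𝒜 = ℂ[u, D⁻¹]`,
`HasDerivAt (t ↦ ev_{γ(t)} a) (Σ_{ij} ev_{γ(t₀)}(∂_{ij} a) · γ′_{ij}) t₀`. [cite: KashiwaraVergne1978, §II.5] [cite: LeeZhu1998, p. 5032] -/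
theorem hasDerivAt_evalAt (a : Carrier) :
    HasDerivAt (fun t => evalAt (γ t) (hdet t) a) (∑ i : Fin 2, ∑ j : Fin 2, evalAt (γ t₀) (hdet t₀) (pd i j a) * γ' i j) t₀ := by
  -- `a · D^n = P`, so `a = P · (D⁻¹)^n`
  obtain ⟨⟨P, D, n, hn⟩, hP⟩ := IsLocalization.surj (Submonoid.powers detPoly) a
  simp only at hn hP
  have hP' : a * uMat.det ^ n = algebraMap (MvPolynomial (Fin 2 × Fin 2) ℂ) Carrier P := by
    rw [det_uMat, ← map_pow, hn]; exact hP
  have ha : a = algebraMap (MvPolynomial (Fin 2 × Fin 2) ℂ) Carrier P * dInv ^ n := by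
    calc a = a * (uMat.det ^ n * dInv ^ n) := by rw [← mul_pow, det_uMat_mul_dInv, one_pow, mul_one]
      _ = algebraMap (MvPolynomial (Fin 2 × Fin 2) ℂ) Carrier P * dInv ^ n := by rw [← mul_assoc, hP']
  rw [ha]
  exact hasDerivAt_evalAt_mul γ γ' t₀ hdet (hasDerivAt_evalAt_algebraMap_mvPolynomial γ γ' t₀ hγ hdet P) (hasDerivAt_evalAt_dInv_pow γ γ' t₀ hγ hdet n)

include hγ hdet in
/-- the same with the derivative abstracted (the shape S2-asm plugs into ★ S2-P PART B's binder `hG : HasDerivAt (t ↦ A(k_{v_t})) G′ 0`). [cite: LeeZhu1998, p. 5032] -/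
theorem hasDerivAt_evalAt_of_eq (a : Carrier) {G' : ℂ} (hG' : G' = ∑ i : Fin 2, ∑ j : Fin 2, evalAt (γ t₀) (hdet t₀) (pd i j a) * γ' i j) :
    HasDerivAt (fun t => evalAt (γ t) (hdet t) a) G' t₀ := by
  rw [hG']
  exact hasDerivAt_evalAt γ γ' t₀ hγ hdet a

end Summit.HodgeConjecture.HodgeConjecture.Cruxes.HLiu418.K2LiuU22CompactPictureChainRule

end
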